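import Summits.CriticalPhenomena.PercolationContinuityZ3.Theorems.PercNearOneGluingNoHeavyLowerTailQ7PsiStarAux
import Mathlib.Algebra.BigOperators.Group.Finset.Powerset
import HarnessLib

/-!
# `NoHeavyLowerTail` (stmt-CriticalPhenomena-4575) — the peeled form of Question 7 on the star class:
# the two star-by-star lower bounds

Support file (`--supports stmt-CriticalPhenomena-4575`), coupling seat `prim-cplus-coupling` (gen 5).  No
definitions, no named facts, no sorries.  Second auxiliary file for `Q7Psi.gpsi_three_star` (file
`…Q7PsiStar`): with `J = {o ↔ x} ∪ {o ↔ y}`, `f = F(C(o)) − F(C(z))` and the star events `σ_B` of the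
observer `o` (`B ⊆ {x,y,z}`; Kozma–Nitzan's Lemma 5 / Theorem 4, arXiv:2401.12397 pp. 12–14),

* `Q7Psi.psi_lower` — `∫_J f ≥ μ(σ_{x})·α° + μ(σ_{y})·β° + μ(σ_{x,y})·DD°`,
* `Q7Psi.psi_sub_delta_lower` — `∫_J f − ∫ (F(C(a)) − F(C(z))) ≥ −μ(σ_∅)·α° + μ(σ_{c})·(γ° − α°) − μ(σ_{z})·α° − μ(σ_{c,z})·η°`
  (`a` a strong relay, `c` the other one),

where `α°, β°, γ°, DD°, η°` are integrals of functions of the configuration OFF `o` (written through the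
restriction `restrictConfig Subtype.val` to `{o}ᶜ`), obtained from the pointwise bounds of file
`…Q7PsiStarAux`, the independence of the star of `o` from the pairs off `o`
(`KNPreFKG.setIntegral_starEvent_comp_restrict`) and the partition into stars
(`KNPreFKG.setIntegral_eq_sum_inter_starEvent`, written out by `Q7Psi.sum_powerset_three`).
[cite: KozmaNitzan2024, Lemma 5 (p. 13), Theorem 4 (pp. 12–14), §5.1 (pp. 31–32)]
-/

namespace Summit.CriticalPhenomena.PercolationContinuityZ3.Theorems

open MeasureTheory Set Literature.Probability.LatticeModels Literature.Probability.Percolation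
open scoped Classical
open KNPreFKG Q7Psi.Star

noncomputable section

namespace Q7Psi

variable {V : Type*}

/-- The sum over the subsets of a three-element set, written out. [folklore] -/
theorem sum_powerset_three [DecidableEq V] {x y z : V} (hxy : x ≠ y) (hxz : x ≠ z) (hyz : y ≠ z)
    (g : Finset V → ℝ) :
    ∑ B ∈ ({x, y, z} : Finset V).powerset, g B =
      g ∅ + g {z} + (g {y} + g {y, z}) + (g {x} + g {x, z} + (g {x, y} + g {x, y, z})) := by
  have hx : x ∉ ({y, z} : Finset V) := by simp [hxy, hxz]
  have hy : y ∉ ({z} : Finset V) := by simp [hyz]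
  have hz : ({z} : Finset V).powerset = {∅, {z}} := by
    ext t; simp [Finset.subset_singleton_iff]
  have hne : (∅ : Finset V) ≠ {z} := (Finset.singleton_ne_empty z).symm
  rw [Finset.sum_powerset_insert hx, Finset.sum_powerset_insert hy, hz, Finset.sum_pair hne, Finset.sum_pair hne,
    Finset.sum_powerset_insert hy, hz, Finset.sum_pair hne, Finset.sum_pair hne]
  simp only [Finset.insert_empty]

variable [Fintype V]

/-- **Lower bound for `Ψ` star by star.**  With `J = {o↔x} ∪ {o↔y}`, `f = F(C(o)) − F(C(z))`, `r` the restriction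
to the pairs off `o` and `x', y', z'` the relays as vertices of `{o}ᶜ`:
`∫_J f ≥ μ(σ_{x})·∫ (F'(C x') − F'(C z'))∘r + μ(σ_{y})·∫ (F'(C y') − F'(C z'))∘r + μ(σ_{x,y})·∫ dd∘r`,
`dd = 𝟙{z' ↮ x', y'}(F'(C x' ∪ C y') − F'(C z'))`, `F' = F ∘ (val '' ·)`.
[cite: KozmaNitzan2024, Lemma 5 (p. 13), Theorem 4 (pp. 13–14)] -/
theorem psi_lower (w : Sym2 V → unitInterval) (o x y z : V) (hxo : x ≠ o) (hyo : y ≠ o) (hzo : z ≠ o)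
    (hxy : x ≠ y) (hxz : x ≠ z) (hyz : y ≠ z) (hiso : ∀ u, u ≠ o → u ∉ ({x, y, z} : Finset V) → w s(o, u) = 0)
    (F : Set V → ℝ) (hF : ∀ S T : Set V, S ⊆ T → F S ≤ F T) :
    (prodBernoulli w).real (starEvent o {x}) *
        ∫ ω, (F (Subtype.val '' openCluster (restrictConfig (Subtype.val : ({o}ᶜ : Set V) → V) ω)
            ⟨x, mem_compl_singleton_iff.2 hxo⟩) -
          F (Subtype.val '' openCluster (restrictConfig (Subtype.val : ({o}ᶜ : Set V) → V) ω)
            ⟨z, mem_compl_singleton_iff.2 hzo⟩)) ∂(prodBernoulli w) +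
      (prodBernoulli w).real (starEvent o {y}) *
        ∫ ω, (F (Subtype.val '' openCluster (restrictConfig (Subtype.val : ({o}ᶜ : Set V) → V) ω)
            ⟨y, mem_compl_singleton_iff.2 hyo⟩) -
          F (Subtype.val '' openCluster (restrictConfig (Subtype.val : ({o}ᶜ : Set V) → V) ω)
            ⟨z, mem_compl_singleton_iff.2 hzo⟩)) ∂(prodBernoulli w) +
      (prodBernoulli w).real (starEvent o {x, y}) *
        ∫ ω, (if (openGraph (restrictConfig (Subtype.val : ({o}ᶜ : Set V) → V) ω)).Reachable
              ⟨z, mem_compl_singleton_iff.2 hzo⟩ ⟨x, mem_compl_singleton_iff.2 hxo⟩ ∨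
            (openGraph (restrictConfig (Subtype.val : ({o}ᶜ : Set V) → V) ω)).Reachable
              ⟨z, mem_compl_singleton_iff.2 hzo⟩ ⟨y, mem_compl_singleton_iff.2 hyo⟩ then (0 : ℝ)
          else F (Subtype.val '' openCluster (restrictConfig (Subtype.val : ({o}ᶜ : Set V) → V) ω)
              ⟨x, mem_compl_singleton_iff.2 hxo⟩ ∪
            Subtype.val '' openCluster (restrictConfig (Subtype.val : ({o}ᶜ : Set V) → V) ω)
              ⟨y, mem_compl_singleton_iff.2 hyo⟩) -
            F (Subtype.val '' openCluster (restrictConfig (Subtype.val : ({o}ᶜ : Set V) → V) ω)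
              ⟨z, mem_compl_singleton_iff.2 hzo⟩)) ∂(prodBernoulli w) ≤
      ∫ ω in (openConn o x ∪ openConn o y), (F (openCluster ω o) - F (openCluster ω z)) ∂(prodBernoulli w) := by
  set μ := prodBernoulli w with hμ
  set r := restrictConfig (Subtype.val : ({o}ᶜ : Set V) → V) with hr
  set x' : ({o}ᶜ : Set V) := ⟨x, mem_compl_singleton_iff.2 hxo⟩ with hx'
  set y' : ({o}ᶜ : Set V) := ⟨y, mem_compl_singleton_iff.2 hyo⟩ with hy'
  set z' : ({o}ᶜ : Set V) := ⟨z, mem_compl_singleton_iff.2 hzo⟩ with hz'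
  have hmeas : ∀ T : Set (BondConfig V), MeasurableSet T := fun _ => MeasurableSet.of_discrete
  have hint : ∀ (k : BondConfig V → ℝ) (T : Set (BondConfig V)), IntegrableOn k T μ :=
    fun k T => (Integrable.of_finite).integrableOn
  set J : Set (BondConfig V) := openConn o x ∪ openConn o y with hJ
  set f : BondConfig V → ℝ := fun ω => F (openCluster ω o) - F (openCluster ω z) with hf
  -- off-`o` clusters read on the restriction
  have hX : ∀ ω, Subtype.val '' openCluster (r ω) x' = {v | ω ∈ openConnIn ({o}ᶜ : Set V) x v} :=
    fun ω => (setOf_openConnIn_eq_image o ω x').symm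
  have hY : ∀ ω, Subtype.val '' openCluster (r ω) y' = {v | ω ∈ openConnIn ({o}ᶜ : Set V) y v} :=
    fun ω => (setOf_openConnIn_eq_image o ω y').symm
  have hZ : ∀ ω, Subtype.val '' openCluster (r ω) z' = {v | ω ∈ openConnIn ({o}ᶜ : Set V) z v} :=
    fun ω => (setOf_openConnIn_eq_image o ω z').symm
  have hRe : ∀ (ω : BondConfig V) (a b : ({o}ᶜ : Set V)),
      (openGraph (r ω)).Reachable a b ↔ ω ∈ openConnIn ({o}ᶜ : Set V) (a : V) b :=
    fun ω a b => reachable_restrictConfig_val_iff _ ω a b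
  -- partition along the stars of `o`
  have ho : o ∉ ({x, y, z} : Finset V) := by simp [hxo.symm, hyo.symm, hzo.symm]
  have hsum := setIntegral_eq_sum_inter_starEvent w {x, y, z} o ho hiso J f
  rw [sum_powerset_three hxy hxz hyz] at hsum
  simp only [Finset.coe_empty, Finset.coe_singleton, Finset.coe_insert] at hsum
  -- stars containing `z`, and the empty star, contribute `0`
  have hzero : ∀ B : Set V, z ∈ B → ∫ ω in J ∩ starEvent o B, f ω ∂μ = 0 := by
    intro B hzB
    rw [setIntegral_congr_fun (hmeas _) (g := fun _ => (0 : ℝ)) fun ω hω => ?_]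
    · simp
    · exact psiIntegrand_z F hω.2 hzB hzo
  have hempty : ∫ ω in J ∩ starEvent o (∅ : Set V), f ω ∂μ = 0 := by
    have : J ∩ starEvent o (∅ : Set V) = ∅ := by
      ext ω
      simp only [mem_inter_iff, mem_empty_iff_false, iff_false, not_and]
      intro hωJ hσ
      rcases hωJ with h | h
      · exact not_reachable_of_empty hσ hxo h
      · exact not_reachable_of_empty hσ hyo h
    rw [this, setIntegral_empty]
  -- star `{x}`
  have hsx : J ∩ starEvent o ({x} : Set V) = starEvent o {x} := by
    refine inter_eq_right.2 fun ω hσ => Or.inl ?_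
    exact (psiIntegrand_x F hF (z := z) hσ hxo hzo).2
  have hbx : μ.real (starEvent o {x}) * ∫ ω, (F (Subtype.val '' openCluster (r ω) x') -
      F (Subtype.val '' openCluster (r ω) z')) ∂μ ≤ ∫ ω in J ∩ starEvent o ({x} : Set V), f ω ∂μ := by
    rw [hsx, ← setIntegral_starEvent_comp_restrict w o {x}
      (fun ω' => F (Subtype.val '' openCluster ω' x') - F (Subtype.val '' openCluster ω' z'))]
    refine setIntegral_mono_on (hint _ _) (hint _ _) (hmeas _) fun ω hσ => ?_
    have h := (psiIntegrand_x F hF (z := z) hσ hxo hzo).1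
    rw [← hX ω, ← hZ ω] at h
    exact h
  -- star `{y}`
  have hsy : J ∩ starEvent o ({y} : Set V) = starEvent o {y} := by
    refine inter_eq_right.2 fun ω hσ => Or.inr ?_
    exact (psiIntegrand_x F hF (z := z) hσ hyo hzo).2
  have hby : μ.real (starEvent o {y}) * ∫ ω, (F (Subtype.val '' openCluster (r ω) y') -
      F (Subtype.val '' openCluster (r ω) z')) ∂μ ≤ ∫ ω in J ∩ starEvent o ({y} : Set V), f ω ∂μ := by
    rw [hsy, ← setIntegral_starEvent_comp_restrict w o {y}
      (fun ω' => F (Subtype.val '' openCluster ω' y') - F (Subtype.val '' openCluster ω' z'))]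
    refine setIntegral_mono_on (hint _ _) (hint _ _) (hmeas _) fun ω hσ => ?_
    have h := (psiIntegrand_x F hF (z := z) hσ hyo hzo).1
    rw [← hY ω, ← hZ ω] at h
    exact h
  -- star `{x, y}`
  have hsxy : J ∩ starEvent o ({x, y} : Set V) = starEvent o {x, y} := by
    refine inter_eq_right.2 fun ω hσ => Or.inl ?_
    exact (psiIntegrand_xy F hF hσ hxo hyo hzo).2
  have hbxy : μ.real (starEvent o {x, y}) * ∫ ω, (if (openGraph (r ω)).Reachable z' x' ∨ (openGraph (r ω)).Reachable z' y'
        then (0 : ℝ) else F (Subtype.val '' openCluster (r ω) x' ∪ Subtype.val '' openCluster (r ω) y') -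
          F (Subtype.val '' openCluster (r ω) z')) ∂μ ≤
      ∫ ω in J ∩ starEvent o ({x, y} : Set V), f ω ∂μ := by
    rw [hsxy, ← setIntegral_starEvent_comp_restrict w o {x, y} (fun ω' => if (openGraph ω').Reachable z' x' ∨
      (openGraph ω').Reachable z' y' then (0 : ℝ) else F (Subtype.val '' openCluster ω' x' ∪ Subtype.val '' openCluster ω' y') -
        F (Subtype.val '' openCluster ω' z'))]
    refine setIntegral_mono_on (hint _ _) (hint _ _) (hmeas _) fun ω hσ => ?_
    have h := (psiIntegrand_xy F hF hσ hxo hyo hzo).1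
    rw [← hX ω, ← hY ω, ← hZ ω, ← hRe ω z' x', ← hRe ω z' y'] at h
    exact h
  rw [hsum, hempty, hzero {z} rfl, hzero {x, z} (Or.inr rfl), hzero {y, z} (Or.inr rfl),
    hzero {x, y, z} (Or.inr (Or.inr rfl))]
  linarith

/-- **Lower bound for `Ψ − Δ_a` star by star** (`a` one of the two strong relays, `c` the other):
with `J = {o↔a} ∪ {o↔c}`, `f = F(C(o)) − F(C(z))`,
`∫_J f − ∫ (F(C(a)) − F(C(z))) ≥ −μ(σ_∅)·α° + μ(σ_{c})·(γ° − α°) − μ(σ_{z})·α° − μ(σ_{c,z})·η°`, where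
`α° = ∫ (F'(C a') − F'(C z'))∘r`, `γ° = ∫ (F'(C c') − F'(C z'))∘r`, `η° = ∫ 𝟙{a' ↮ c', z'}(F'(C a') − F'(C z'))∘r`.
[cite: KozmaNitzan2024, Lemma 5 (p. 13), Theorem 4 (pp. 13–14)] -/
theorem psi_sub_delta_lower (w : Sym2 V → unitInterval) (o a c z : V) (hao : a ≠ o) (hco : c ≠ o) (hzo : z ≠ o)
    (hac : a ≠ c) (haz : a ≠ z) (hcz : c ≠ z) (hiso : ∀ u, u ≠ o → u ∉ ({a, c, z} : Finset V) → w s(o, u) = 0)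
    (F : Set V → ℝ) (hF : ∀ S T : Set V, S ⊆ T → F S ≤ F T) :
    -((prodBernoulli w).real (starEvent o ∅) *
        ∫ ω, (F (Subtype.val '' openCluster (restrictConfig (Subtype.val : ({o}ᶜ : Set V) → V) ω)
            ⟨a, mem_compl_singleton_iff.2 hao⟩) -
          F (Subtype.val '' openCluster (restrictConfig (Subtype.val : ({o}ᶜ : Set V) → V) ω)
            ⟨z, mem_compl_singleton_iff.2 hzo⟩)) ∂(prodBernoulli w)) +
      (prodBernoulli w).real (starEvent o {c}) *
        (∫ ω, (F (Subtype.val '' openCluster (restrictConfig (Subtype.val : ({o}ᶜ : Set V) → V) ω)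
            ⟨c, mem_compl_singleton_iff.2 hco⟩) -
          F (Subtype.val '' openCluster (restrictConfig (Subtype.val : ({o}ᶜ : Set V) → V) ω)
            ⟨z, mem_compl_singleton_iff.2 hzo⟩)) ∂(prodBernoulli w) -
        ∫ ω, (F (Subtype.val '' openCluster (restrictConfig (Subtype.val : ({o}ᶜ : Set V) → V) ω)
            ⟨a, mem_compl_singleton_iff.2 hao⟩) -
          F (Subtype.val '' openCluster (restrictConfig (Subtype.val : ({o}ᶜ : Set V) → V) ω)
            ⟨z, mem_compl_singleton_iff.2 hzo⟩)) ∂(prodBernoulli w)) -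
      (prodBernoulli w).real (starEvent o {z}) *
        ∫ ω, (F (Subtype.val '' openCluster (restrictConfig (Subtype.val : ({o}ᶜ : Set V) → V) ω)
            ⟨a, mem_compl_singleton_iff.2 hao⟩) -
          F (Subtype.val '' openCluster (restrictConfig (Subtype.val : ({o}ᶜ : Set V) → V) ω)
            ⟨z, mem_compl_singleton_iff.2 hzo⟩)) ∂(prodBernoulli w) -
      (prodBernoulli w).real (starEvent o {c, z}) *
        ∫ ω, (if (openGraph (restrictConfig (Subtype.val : ({o}ᶜ : Set V) → V) ω)).Reachable
              ⟨a, mem_compl_singleton_iff.2 hao⟩ ⟨c, mem_compl_singleton_iff.2 hco⟩ ∨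
            (openGraph (restrictConfig (Subtype.val : ({o}ᶜ : Set V) → V) ω)).Reachable
              ⟨a, mem_compl_singleton_iff.2 hao⟩ ⟨z, mem_compl_singleton_iff.2 hzo⟩ then (0 : ℝ)
          else F (Subtype.val '' openCluster (restrictConfig (Subtype.val : ({o}ᶜ : Set V) → V) ω)
              ⟨a, mem_compl_singleton_iff.2 hao⟩) -
            F (Subtype.val '' openCluster (restrictConfig (Subtype.val : ({o}ᶜ : Set V) → V) ω)
              ⟨z, mem_compl_singleton_iff.2 hzo⟩)) ∂(prodBernoulli w) ≤
      ∫ ω in (openConn o a ∪ openConn o c), (F (openCluster ω o) - F (openCluster ω z)) ∂(prodBernoulli w) -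
        ∫ ω, (F (openCluster ω a) - F (openCluster ω z)) ∂(prodBernoulli w) := by
  set μ := prodBernoulli w with hμ
  set r := restrictConfig (Subtype.val : ({o}ᶜ : Set V) → V) with hr
  set a' : ({o}ᶜ : Set V) := ⟨a, mem_compl_singleton_iff.2 hao⟩ with ha'
  set c' : ({o}ᶜ : Set V) := ⟨c, mem_compl_singleton_iff.2 hco⟩ with hc'
  set z' : ({o}ᶜ : Set V) := ⟨z, mem_compl_singleton_iff.2 hzo⟩ with hz'
  have hmeas : ∀ T : Set (BondConfig V), MeasurableSet T := fun _ => MeasurableSet.of_discrete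
  have hint : ∀ (k : BondConfig V → ℝ) (T : Set (BondConfig V)), IntegrableOn k T μ :=
    fun k T => (Integrable.of_finite).integrableOn
  set J : Set (BondConfig V) := openConn o a ∪ openConn o c with hJ
  set f : BondConfig V → ℝ := fun ω => F (openCluster ω o) - F (openCluster ω z) with hf
  set d : BondConfig V → ℝ := fun ω => F (openCluster ω a) - F (openCluster ω z) with hd
  have hA : ∀ ω, Subtype.val '' openCluster (r ω) a' = {v | ω ∈ openConnIn ({o}ᶜ : Set V) a v} :=
    fun ω => (setOf_openConnIn_eq_image o ω a').symm
  have hC : ∀ ω, Subtype.val '' openCluster (r ω) c' = {v | ω ∈ openConnIn ({o}ᶜ : Set V) c v} :=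
    fun ω => (setOf_openConnIn_eq_image o ω c').symm
  have hZ : ∀ ω, Subtype.val '' openCluster (r ω) z' = {v | ω ∈ openConnIn ({o}ᶜ : Set V) z v} :=
    fun ω => (setOf_openConnIn_eq_image o ω z').symm
  have hRe : ∀ (ω : BondConfig V) (p q : ({o}ᶜ : Set V)),
      (openGraph (r ω)).Reachable p q ↔ ω ∈ openConnIn ({o}ᶜ : Set V) (p : V) q :=
    fun ω p q => reachable_restrictConfig_val_iff _ ω p q
  -- partitions along the stars of `o`
  have ho : o ∉ ({a, c, z} : Finset V) := by simp [hao.symm, hco.symm, hzo.symm]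
  have hsumJ := setIntegral_eq_sum_inter_starEvent w {a, c, z} o ho hiso J f
  have hsumD := setIntegral_eq_sum_inter_starEvent w {a, c, z} o ho hiso univ d
  rw [sum_powerset_three hac haz hcz] at hsumJ hsumD
  simp only [Finset.coe_empty, Finset.coe_singleton, Finset.coe_insert, univ_inter] at hsumJ hsumD
  rw [setIntegral_univ] at hsumD
  -- `T_B = ∫_{J ∩ σ_B} f`: zero for `B ∋ z` and `B = ∅`; `T_B = D_B` for `B ∋ a`
  have hzero : ∀ B : Set V, z ∈ B → ∫ ω in J ∩ starEvent o B, f ω ∂μ = 0 := by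
    intro B hzB
    rw [setIntegral_congr_fun (hmeas _) (g := fun _ => (0 : ℝ)) fun ω hω => ?_]
    · simp
    · exact psiIntegrand_z F hω.2 hzB hzo
  have hempty : ∫ ω in J ∩ starEvent o (∅ : Set V), f ω ∂μ = 0 := by
    have : J ∩ starEvent o (∅ : Set V) = ∅ := by
      ext ω
      simp only [mem_inter_iff, mem_empty_iff_false, iff_false, not_and]
      intro hωJ hσ
      rcases hωJ with h | h
      · exact not_reachable_of_empty hσ hao h
      · exact not_reachable_of_empty hσ hco h
    rw [this, setIntegral_empty]
  have hsame : ∀ B : Set V, a ∈ B → ∫ ω in J ∩ starEvent o B, f ω ∂μ = ∫ ω in starEvent o B, d ω ∂μ := by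
    intro B haB
    have hJB : J ∩ starEvent o B = starEvent o B :=
      inter_eq_right.2 fun ω hσ => Or.inl (openCluster_x_of_mem hσ haB hao).2
    rw [hJB]
    refine setIntegral_congr_fun (hmeas _) fun ω hσ => ?_
    simp only [hf, hd, (openCluster_x_of_mem hσ haB hao).1]
  -- `B = ∅`: `D_∅ = μ(σ_∅)·α°`
  have hDempty : ∫ ω in starEvent o (∅ : Set V), d ω ∂μ = μ.real (starEvent o ∅) *
      ∫ ω, (F (Subtype.val '' openCluster (r ω) a') - F (Subtype.val '' openCluster (r ω) z')) ∂μ := by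
    rw [← setIntegral_starEvent_comp_restrict w o ∅
      (fun ω' => F (Subtype.val '' openCluster ω' a') - F (Subtype.val '' openCluster ω' z'))]
    refine setIntegral_congr_fun (hmeas _) fun ω hσ => ?_
    have h := diffIntegrand_empty F (x := a) (z := z) hσ hao hzo
    rw [← hA ω, ← hZ ω] at h
    exact h
  -- `B = {c}`: `T − D ≥ μ(σ_c)·(γ° − α°)`
  have hJc : J ∩ starEvent o ({c} : Set V) = starEvent o {c} :=
    inter_eq_right.2 fun ω hσ => Or.inr (diffIntegrand_y F hF (x := a) hσ hao hco).2
  have hDc : μ.real (starEvent o {c}) * (∫ ω, (F (Subtype.val '' openCluster (r ω) c') -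
      F (Subtype.val '' openCluster (r ω) z')) ∂μ - ∫ ω, (F (Subtype.val '' openCluster (r ω) a') -
      F (Subtype.val '' openCluster (r ω) z')) ∂μ) ≤
      ∫ ω in J ∩ starEvent o ({c} : Set V), f ω ∂μ - ∫ ω in starEvent o ({c} : Set V), d ω ∂μ := by
    rw [hJc, ← integral_sub (Integrable.of_finite) (Integrable.of_finite),
      ← integral_sub (hint _ _) (hint _ _)]
    have e : (fun ω => F (Subtype.val '' openCluster (r ω) c') - F (Subtype.val '' openCluster (r ω) z') -
        (F (Subtype.val '' openCluster (r ω) a') - F (Subtype.val '' openCluster (r ω) z'))) =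
        fun ω => (fun ω' => F (Subtype.val '' openCluster ω' c') - F (Subtype.val '' openCluster ω' a')) (r ω) := by
      funext ω; ring
    rw [e, ← setIntegral_starEvent_comp_restrict w o {c}
      (fun ω' => F (Subtype.val '' openCluster ω' c') - F (Subtype.val '' openCluster ω' a'))]
    refine setIntegral_mono_on (hint _ _) (hint _ _) (hmeas _) fun ω hσ => ?_
    have h := (diffIntegrand_y F hF (x := a) hσ hao hco).1
    rw [← hA ω, ← hC ω] at h
    simp only [hf, hd]
    linarith
  -- `B = {z}`: `D ≤ μ(σ_z)·α°`
  have hDz : ∫ ω in starEvent o ({z} : Set V), d ω ∂μ ≤ μ.real (starEvent o {z}) *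
      ∫ ω, (F (Subtype.val '' openCluster (r ω) a') - F (Subtype.val '' openCluster (r ω) z')) ∂μ := by
    rw [← setIntegral_starEvent_comp_restrict w o {z}
      (fun ω' => F (Subtype.val '' openCluster ω' a') - F (Subtype.val '' openCluster ω' z'))]
    refine setIntegral_mono_on (hint _ _) (hint _ _) (hmeas _) fun ω hσ => ?_
    have h := (diffIntegrand_z F hF (x := a) hσ hao hzo).1
    rw [← hA ω, ← hZ ω] at h
    exact h
  -- `B = {c, z}`: `D ≤ μ(σ_{c,z})·η°`
  have hDcz : ∫ ω in starEvent o ({c, z} : Set V), d ω ∂μ ≤ μ.real (starEvent o {c, z}) *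
      ∫ ω, (if (openGraph (r ω)).Reachable a' c' ∨ (openGraph (r ω)).Reachable a' z' then (0 : ℝ)
        else F (Subtype.val '' openCluster (r ω) a') - F (Subtype.val '' openCluster (r ω) z')) ∂μ := by
    rw [← setIntegral_starEvent_comp_restrict w o {c, z} (fun ω' => if (openGraph ω').Reachable a' c' ∨
      (openGraph ω').Reachable a' z' then (0 : ℝ) else F (Subtype.val '' openCluster ω' a') - F (Subtype.val '' openCluster ω' z'))]
    refine setIntegral_mono_on (hint _ _) (hint _ _) (hmeas _) fun ω hσ => ?_
    have h := (diffIntegrand_yz F hF (x := a) hσ hao hco hzo).1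
    rw [← hA ω, ← hZ ω, ← hRe ω a' c', ← hRe ω a' z'] at h
    exact h
  have hs0 : 0 ≤ μ.real (starEvent o ({z} : Set V)) := measureReal_nonneg
  rw [hsumJ, hsumD, hempty, hzero {z} rfl, hzero {c, z} (Or.inr rfl), hsame {a} rfl, hsame {a, z} (Or.inl rfl),
    hsame {a, c} (Or.inl rfl), hsame {a, c, z} (Or.inl rfl), hDempty]
  linarith

end Q7Psi

end

end Summit.CriticalPhenomena.PercolationContinuityZ3.Theorems
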